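import Mathlib.Analysis.Complex.PhragmenLindelof
import Mathlib.Analysis.SpecialFunctions.Trigonometric.Inverse
import Summits.RiemannHypothesis.RiemannHypothesis.Theorems.SoloInformedGroundStatePairing
import Literature.NumberTheory.LFunctions.WeilMellinInversion
import Literature.NumberTheory.LFunctions.WeilArchimedeanMoments
import HarnessLib

/-!
# T63a — gap penetration for entire functions of exponential type

If `F` is entire, `‖F z‖ ≤ M e^{a|Im z|}`, and `‖F t‖ ≤ η` for real `|t| ≥ Ω`, then
`‖F x‖ ≤ η e^{a√(Ω² - x²)} ≤ η e^{aΩ}` for real `|x| ≤ Ω`: smallness OUTSIDE a window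
penetrates the window at the price `e^{aΩ}`, independently of `M`
(`norm_le_of_small_off_interval`).  Proof: Phragmén–Lindelöf (Mathlib,
`PhragmenLindelof.vertical_strip`) on the strip `|Re w| ≤ π/2` for
`Φ(w) = F(Ω sin w) e^{-aΩ cos w}`: the sine map sends the two edges of the strip onto the two
rays `|t| ≥ Ω`, the multiplier has modulus `e^{-aΩ cos u cosh v}` inside (which absorbs the
type, since `|Im(Ω sin w)| = Ω cos u |sinh v|`) and modulus `1` on the edges.

Applied to `F(z) = ĝ(1/2 + iz)` for a Weil test function `g` supported in `[-a, a]`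
(`norm_weilMellin_le_window` supplies `M = √(2a) ‖g‖₂`), it yields the ENERGY INEQUALITY
`2π ∫|g|² ≤ ∫_{|t| ≥ Ω} |ĝ(1/2+it)|² dt + 2Ω e^{2aΩ} η²` whenever `|ĝ(1/2+it)| ≤ η` for
`|t| ≥ Ω` (`two_pi_weilNorm2Sq_le_leak_add`): the pointwise half of "a time-limited function
leaks outside every frequency window" (Fuchs 1964; Slepian–Landau–Pollak), completed to an
`L²` statement in `SoloInformedTimeLimitLeak`.
-/

open Complex Set Filter MeasureTheory Literature.NumberTheory.LFunctions
open scoped Real Topology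

namespace Summit.RiemannHypothesis.RiemannHypothesis.Theorems

/-! ## Elementary identities -/

/-- `sin(u + iv) = sin u cosh v + i cos u sinh v` with real coefficients. -/
theorem sin_re_im_decomp (w : ℂ) :
    Complex.sin w = ((Real.sin w.re * Real.cosh w.im : ℝ) : ℂ)
      + ((Real.cos w.re * Real.sinh w.im : ℝ) : ℂ) * I := by
  rw [Complex.sin_eq]
  push_cast
  ring

/-- `cos(u + iv) = cos u cosh v - i sin u sinh v` with real coefficients. -/
theorem cos_re_im_decomp (w : ℂ) :
    Complex.cos w = ((Real.cos w.re * Real.cosh w.im : ℝ) : ℂ)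
      - ((Real.sin w.re * Real.sinh w.im : ℝ) : ℂ) * I := by
  rw [Complex.cos_eq]
  push_cast
  ring

/-- `Im(Ω sin(u + iv)) = Ω cos u sinh v` for real `Ω`. -/
theorem im_real_mul_sin (Ω : ℝ) (w : ℂ) :
    ((Ω : ℂ) * Complex.sin w).im = Ω * (Real.cos w.re * Real.sinh w.im) := by
  rw [sin_re_im_decomp]
  simp only [mul_im, add_re, add_im, mul_re, ofReal_re, ofReal_im, I_re, I_im]
  ring

/-- `|e^{-c cos(u+iv)}| = e^{-c cos u cosh v}` for real `c`. -/
theorem norm_cexp_neg_real_mul_cos (c : ℝ) (w : ℂ) :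
    ‖cexp (-(c : ℂ) * Complex.cos w)‖ = Real.exp (-(c * (Real.cos w.re * Real.cosh w.im))) := by
  rw [Complex.norm_exp, cos_re_im_decomp]
  congr 1
  simp only [neg_mul, neg_re, mul_re, sub_re, sub_im, mul_im, ofReal_re, ofReal_im, I_re, I_im]
  ring

/-! ## Gap penetration -/

/-- **Gap penetration (Phragmén–Lindelöf).** `F` entire, `‖F z‖ ≤ M e^{a|Im z|}`, and
`‖F t‖ ≤ η` for real `|t| ≥ Ω > 0`; then `‖F x‖ ≤ η e^{a√(Ω² - x²)}` for real `|x| ≤ Ω`. -/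
theorem norm_le_of_small_off_interval {F : ℂ → ℂ} (hF : Differentiable ℂ F) {M a Ω η : ℝ}
    (ha : 0 ≤ a) (hΩ : 0 < Ω) (hM : ∀ z, ‖F z‖ ≤ M * Real.exp (a * |z.im|))
    (hη : ∀ t : ℝ, Ω ≤ |t| → ‖F t‖ ≤ η) {x : ℝ} (hx : |x| ≤ Ω) :
    ‖F x‖ ≤ η * Real.exp (a * Real.sqrt (Ω ^ 2 - x ^ 2)) := by
  set c : ℝ := a * Ω with hc
  set Φ : ℂ → ℂ := fun w ↦ F ((Ω : ℂ) * Complex.sin w) * cexp (-(c : ℂ) * Complex.cos w)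
    with hΦ
  have hΦd : Differentiable ℂ Φ := by
    refine Differentiable.mul (hF.comp ?_) ?_
    · exact (differentiable_const _).mul Complex.differentiable_sin
    · exact ((differentiable_const _).mul Complex.differentiable_cos).cexp
  have hΦn : ∀ w : ℂ, ‖Φ w‖ = ‖F ((Ω : ℂ) * Complex.sin w)‖ *
      Real.exp (-(c * (Real.cos w.re * Real.cosh w.im))) := fun w ↦ by
    rw [hΦ]
    dsimp only
    rw [norm_mul, norm_cexp_neg_real_mul_cos]
  have hM0 : 0 ≤ M := by
    have h := hM 0
    simp only [zero_im, abs_zero, mul_zero, Real.exp_zero, mul_one] at h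
    exact (norm_nonneg _).trans h
  -- interior bound: `‖Φ‖ ≤ M` on the closed strip
  have hin : ∀ w : ℂ, |w.re| ≤ π / 2 → ‖Φ w‖ ≤ M := by
    intro w hw
    have hcos : 0 ≤ Real.cos w.re := Real.cos_nonneg_of_mem_Icc (abs_le.1 hw)
    rw [hΦn]
    calc ‖F ((Ω : ℂ) * Complex.sin w)‖ * Real.exp (-(c * (Real.cos w.re * Real.cosh w.im)))
        ≤ M * Real.exp (a * |((Ω : ℂ) * Complex.sin w).im|)
            * Real.exp (-(c * (Real.cos w.re * Real.cosh w.im))) :=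
          mul_le_mul_of_nonneg_right (hM _) (Real.exp_pos _).le
      _ ≤ M := by
          rw [im_real_mul_sin, mul_assoc, ← Real.exp_add]
          refine mul_le_of_le_one_right hM0 (Real.exp_le_one_iff.2 ?_)
          have h1 : |Ω * (Real.cos w.re * Real.sinh w.im)| =
              Ω * (Real.cos w.re * |Real.sinh w.im|) := by
            rw [abs_mul, abs_mul, abs_of_pos hΩ, abs_of_nonneg hcos]
          have h0 : |Real.sinh w.im| ≤ Real.cosh w.im := by
            rw [abs_le]
            refine ⟨?_, (Real.sinh_lt_cosh _).le⟩
            have h := Real.sinh_lt_cosh (-w.im)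
            rw [Real.sinh_neg, Real.cosh_neg] at h
            linarith
          have h2 : Real.cos w.re * |Real.sinh w.im| ≤ Real.cos w.re * Real.cosh w.im :=
            mul_le_mul_of_nonneg_left h0 hcos
          have h3 : a * (Ω * (Real.cos w.re * |Real.sinh w.im|)) ≤
              a * (Ω * (Real.cos w.re * Real.cosh w.im)) :=
            mul_le_mul_of_nonneg_left (mul_le_mul_of_nonneg_left h2 hΩ.le) ha
          rw [h1, hc]
          linarith
  -- boundary bound: `‖Φ‖ ≤ η` on the edges `Re w = ± π/2`
  have hbd : ∀ w : ℂ, Real.cos w.re = 0 → |Real.sin w.re| = 1 → ‖Φ w‖ ≤ η := by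
    intro w hcos hsin
    rw [hΦn, hcos]
    simp only [zero_mul, mul_zero, neg_zero, Real.exp_zero, mul_one]
    have hreal : (Ω : ℂ) * Complex.sin w =
        ((Ω * (Real.sin w.re * Real.cosh w.im) : ℝ) : ℂ) := by
      rw [sin_re_im_decomp, hcos]
      push_cast
      ring
    rw [hreal]
    apply hη
    rw [abs_mul, abs_mul, hsin, abs_of_pos hΩ, one_mul, abs_of_pos (Real.cosh_pos _)]
    exact le_mul_of_one_le_right hΩ.le (Real.one_le_cosh _)
  -- Phragmén–Lindelöf on the strip `-π/2 < Re w < π/2`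
  have hPL : ∀ w : ℂ, -(π / 2) ≤ w.re → w.re ≤ π / 2 → ‖Φ w‖ ≤ η := by
    intro w h1 h2
    refine PhragmenLindelof.vertical_strip (a := -(π / 2)) (b := π / 2) (f := Φ)
      hΦd.diffContOnCl ⟨0, ?_, 0, ?_⟩ (fun z hz ↦ ?_) (fun z hz ↦ ?_) h1 h2
    · have : π / 2 - -(π / 2) = π := by ring
      rw [this, div_self Real.pi_ne_zero]
      exact one_pos
    · refine Asymptotics.IsBigO.of_bound M ?_
      refine eventually_inf_principal.2 (Eventually.of_forall fun z hz ↦ ?_)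
      have hz' : |z.re| < π / 2 := abs_lt.2 ⟨hz.1, hz.2⟩
      simp only [zero_mul, Real.exp_zero, norm_one, mul_one]
      exact hin z hz'.le
    · refine hbd z ?_ ?_
      · rw [hz, Real.cos_neg, Real.cos_pi_div_two]
      · rw [hz, Real.sin_neg, Real.sin_pi_div_two, abs_neg, abs_one]
    · refine hbd z ?_ ?_
      · rw [hz, Real.cos_pi_div_two]
      · rw [hz, Real.sin_pi_div_two, abs_one]
  -- evaluate at `w = arcsin (x/Ω)`
  have hxΩ : |x / Ω| ≤ 1 := by
    rw [abs_div, abs_of_pos hΩ, div_le_one hΩ]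
    exact hx
  obtain ⟨hl, hr⟩ := abs_le.1 hxΩ
  set u : ℝ := Real.arcsin (x / Ω) with hu
  have hsu : Real.sin u = x / Ω := Real.sin_arcsin hl hr
  have hcu : Real.cos u = Real.sqrt (1 - (x / Ω) ^ 2) := Real.cos_arcsin _
  have key := hPL u (by simpa using Real.neg_pi_div_two_le_arcsin (x / Ω))
    (by simpa using Real.arcsin_le_pi_div_two (x / Ω))
  rw [hΦn] at key
  simp only [ofReal_re, ofReal_im, Real.cosh_zero, mul_one] at key
  have hΩc : (Ω : ℂ) ≠ 0 := ofReal_ne_zero.2 hΩ.ne'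
  have harg : (Ω : ℂ) * Complex.sin (u : ℂ) = (x : ℂ) := by
    rw [← ofReal_sin, hsu]
    push_cast
    field_simp
  have hsq : c * Real.sqrt (1 - (x / Ω) ^ 2) = a * Real.sqrt (Ω ^ 2 - x ^ 2) := by
    rw [hc, mul_assoc]
    congr 1
    have hΩ0 : Ω ≠ 0 := hΩ.ne'
    calc Ω * Real.sqrt (1 - (x / Ω) ^ 2)
        = Real.sqrt (Ω ^ 2) * Real.sqrt (1 - (x / Ω) ^ 2) := by rw [Real.sqrt_sq hΩ.le]
      _ = Real.sqrt (Ω ^ 2 * (1 - (x / Ω) ^ 2)) := (Real.sqrt_mul (sq_nonneg _) _).symm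
      _ = Real.sqrt (Ω ^ 2 - x ^ 2) := by
          congr 1
          field_simp
  rw [harg, hcu, hsq] at key
  calc ‖F x‖ = ‖F x‖ * Real.exp (-(a * Real.sqrt (Ω ^ 2 - x ^ 2)))
        * Real.exp (a * Real.sqrt (Ω ^ 2 - x ^ 2)) := by
        rw [mul_assoc, ← Real.exp_add, neg_add_cancel, Real.exp_zero, mul_one]
    _ ≤ η * Real.exp (a * Real.sqrt (Ω ^ 2 - x ^ 2)) :=
        mul_le_mul_of_nonneg_right key (Real.exp_pos _).le

/-- **Gap penetration, window form**: under the same hypotheses `‖F x‖ ≤ η e^{aΩ}` on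
`[-Ω, Ω]`. -/
theorem norm_le_of_small_off_interval' {F : ℂ → ℂ} (hF : Differentiable ℂ F) {M a Ω η : ℝ}
    (ha : 0 ≤ a) (hΩ : 0 < Ω) (hM : ∀ z, ‖F z‖ ≤ M * Real.exp (a * |z.im|))
    (hη : ∀ t : ℝ, Ω ≤ |t| → ‖F t‖ ≤ η) {x : ℝ} (hx : |x| ≤ Ω) :
    ‖F x‖ ≤ η * Real.exp (a * Ω) := by
  have hη0 : 0 ≤ η := (norm_nonneg _).trans (hη Ω (by rw [abs_of_pos hΩ]))
  refine (norm_le_of_small_off_interval hF ha hΩ hM hη hx).trans ?_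
  refine mul_le_mul_of_nonneg_left (Real.exp_le_exp.2 (mul_le_mul_of_nonneg_left ?_ ha)) hη0
  calc Real.sqrt (Ω ^ 2 - x ^ 2) ≤ Real.sqrt (Ω ^ 2) :=
        Real.sqrt_le_sqrt (by nlinarith [sq_nonneg x])
    _ = Ω := Real.sqrt_sq hΩ.le

/-! ## The Weil transform on the critical line -/

/-- `z ↦ ĝ(1/2 + iz)` is entire for a test function `g`. -/
theorem differentiable_weilMellin_line_ext {g : ℝ → ℂ} (hg : IsWeilTest g) :
    Differentiable ℂ fun z : ℂ ↦ weilMellin g (1 / 2 + z * I) :=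
  (differentiable_weilMellin hg.1.continuous hg.2).comp
    ((differentiable_const _).add (differentiable_id.mul (differentiable_const _)))

/-- Exponential type: `|ĝ(1/2 + iz)| ≤ √(2a) ‖g‖₂ e^{a |Im z|}` for `g` supported in
`[-a, a]`. -/
theorem norm_weilMellin_line_ext_le {g : ℝ → ℂ} {a : ℝ} (hg : IsWeilTest g)
    (hga : tsupport g ⊆ Icc (-a) a) (ha : 0 ≤ a) (z : ℂ) :
    ‖weilMellin g (1 / 2 + z * I)‖ ≤
      (Real.sqrt (2 * a) * Real.sqrt (∫ t, ‖g t‖ ^ 2)) * Real.exp (a * |z.im|) := by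
  have h := norm_weilMellin_le_window hg hga ha (1 / 2 + z * I)
  have hre : |(1 / 2 + z * I).re - 1 / 2| = |z.im| := by
    have : (1 / 2 + z * I).re - 1 / 2 = -z.im := by
      simp [mul_re]
    rw [this, abs_neg]
  rw [hre, mul_comm |z.im| a] at h
  linarith [h]

/-- **Gap penetration for `ĝ`.** If `|ĝ(1/2+it)| ≤ η` for `|t| ≥ Ω`, then
`|ĝ(1/2+ix)| ≤ η e^{aΩ}` for `|x| ≤ Ω` (`g` a test function supported in `[-a, a]`). -/
theorem norm_weilMellin_le_of_small_off_interval {g : ℝ → ℂ} {a Ω η : ℝ} (hg : IsWeilTest g)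
    (hga : tsupport g ⊆ Icc (-a) a) (ha : 0 ≤ a) (hΩ : 0 < Ω)
    (hη : ∀ t : ℝ, Ω ≤ |t| → ‖weilMellin g (1 / 2 + t * I)‖ ≤ η) {x : ℝ} (hx : |x| ≤ Ω) :
    ‖weilMellin g (1 / 2 + x * I)‖ ≤ η * Real.exp (a * Ω) :=
  norm_le_of_small_off_interval' (F := fun z ↦ weilMellin g (1 / 2 + z * I))
    (differentiable_weilMellin_line_ext hg) ha hΩ (norm_weilMellin_line_ext_le hg hga ha) hη hx

/-- **Energy inequality.** For a test function `g` supported in `[-a, a]` and `Ω > 0`: if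
`|ĝ(1/2+it)| ≤ η` for all `|t| ≥ Ω`, then
`2π ‖g‖₂² ≤ ∫_{|t| ≥ Ω} |ĝ(1/2+it)|² dt + 2Ω (η e^{aΩ})²` (Plancherel + gap penetration). -/
theorem two_pi_weilNorm2Sq_le_leak_add {g : ℝ → ℂ} {a Ω η : ℝ} (hg : IsWeilTest g)
    (hga : tsupport g ⊆ Icc (-a) a) (ha : 0 ≤ a) (hΩ : 0 < Ω)
    (hη : ∀ t : ℝ, Ω ≤ |t| → ‖weilMellin g (1 / 2 + t * I)‖ ≤ η) :
    2 * π * weilNorm2Sq g ≤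
      (∫ t in {t : ℝ | Ω ≤ |t|}, ‖weilMellin g (1 / 2 + t * I)‖ ^ 2)
        + 2 * Ω * (η * Real.exp (a * Ω)) ^ 2 := by
  set F : ℝ → ℝ := fun t ↦ ‖weilMellin g (1 / 2 + t * I)‖ ^ 2 with hFdef
  have hint : Integrable F := integrable_norm_sq_weilMellin_half_line hg
  have htot : ∫ t, F t = 2 * π * weilNorm2Sq g := integral_norm_sq_weilMellin_half_line hg
  have hS : {t : ℝ | Ω ≤ |t|} = (Ioo (-Ω) Ω)ᶜ := by
    ext t
    simp only [mem_setOf_eq, mem_compl_iff, mem_Ioo, not_and_or, not_lt, le_abs']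
  have hsplit := integral_add_compl (measurableSet_Ioo (a := -Ω) (b := Ω)) hint
  rw [← hS, htot] at hsplit
  have hin : ∫ t in Ioo (-Ω) Ω, F t ≤ ∫ t in Ioo (-Ω) Ω, (η * Real.exp (a * Ω)) ^ 2 := by
    refine setIntegral_mono_on hint.integrableOn (integrableOn_const measure_Ioo_lt_top.ne)
      measurableSet_Ioo fun t ht ↦ ?_
    have ht' : |t| ≤ Ω := (abs_lt.2 ⟨ht.1, ht.2⟩).le
    exact pow_le_pow_left₀ (norm_nonneg _)
      (norm_weilMellin_le_of_small_off_interval hg hga ha hΩ hη ht') 2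
  rw [setIntegral_const, Real.volume_real_Ioo_of_le (by linarith), smul_eq_mul] at hin
  have h2 : (Ω - -Ω) * (η * Real.exp (a * Ω)) ^ 2 = 2 * Ω * (η * Real.exp (a * Ω)) ^ 2 := by
    ring
  linarith [hsplit, hin, h2]

end Summit.RiemannHypothesis.RiemannHypothesis.Theorems
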